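import Literature.Analysis.ODE.LinearSecondOrder
import Mathlib.Analysis.SpecialFunctions.ExpDeriv
import Mathlib.Analysis.Calculus.MeanValue
import Mathlib.Analysis.Calculus.Deriv.Star
import Mathlib.Analysis.ODE.Gronwall
import HarnessLib

/-!
# The equation `y'' = Q(t) y` with real or complex coefficient: solutions on a set, Wronskian,
# linear structure, continuous dependence on the coefficient

Topic `Literature/Analysis/ODE` (namespace `Literature.Analysis.ODE`), the `p = 0` case of
`LinearSecondOrder.lean` (`u'' = p u' + q u`, `𝕜 = ℝ` or `ℂ`) packaged for the qualitative theory of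
recessive / dominant solutions (`RecessiveSolution.lean`) and for shooting arguments in a spectral
parameter (the radial Klein–Gordon equation on Kerr, Shlapentokh-Rothman, CMP 329 (2014), §4 and
App. C). Everything is proved:

* `IsSol2 Q y y' s` — `y` has derivative `y'` and `y'` has derivative `Q t · y t` at every point of
  `s` (a solution "on `s`", classical, `𝕜`-valued, `𝕜 = ℝ` or `ℂ`); algebra (`add`, `smul`, `neg`,
  `sub`), restriction, existence on a half-line `(r₀, ∞)` with prescribed data
  (`exists_isSol2_Ioi`, from `exists_solution_Ioi`) and uniqueness (`IsSol2.eqOn_Ioi`).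
* `wronskian y y' z z' t = y t · z' t − y' t · z t` is constant along two solutions
  (`IsSol2.wronskian_eq`); the **basis representation** on `(r₀, ∞)`: every solution is the
  combination of two solutions with non-vanishing Wronskian (`IsSol2.eq_combination`).
* `hasDerivAt_normSq`, `IsSol2.hasDerivAt_normSq`, `IsSol2.hasDerivAt_reInner` — the calculus of
  `t ↦ ‖y t‖²` and `t ↦ re (conj (y t) · y' t)` along a solution
  (`(‖y‖²)' = 2 re(ȳ y')`, `(re(ȳ y'))' = ‖y'‖² + re Q · ‖y‖²`).
* `IsSol2.dist_le` — **continuous dependence on the coefficient and the data** on a compact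
  interval `[a, b] ∋ t₀` (Grönwall in the quantitative form of Mathlib's
  `dist_le_of_approx_trajectories_ODE_of_mem`, forward, and backward by the reflection `t ↦ −t`):
  `dist (y t, y' t) (z t, z' t) ≤ (dist of the data at t₀ + η P (b − a)) e^{K (b − a)}` when
  `‖Q₁‖ ≤ K` (`K ≥ 1`), `‖Q₁ − Q₂‖ ≤ η`, `‖z‖ ≤ P` on `[a, b]`.

## References
* P. Hartman, *Ordinary Differential Equations*, Classics in Applied Mathematics 38 (SIAM 2002),
  Ch. IV §1 (Lemma 1.1, Cor. 1.1), Ch. IV §8 (the Wronskian, (8.4)), Ch. V Thm. 2.1. Key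
  `Hartman2002`.
-/

noncomputable section

open Set Metric Filter
open scoped Topology ComplexConjugate NNReal ContDiff

namespace Literature.Analysis.ODE

variable {𝕜 : Type*} [RCLike 𝕜]

/-! ## Solutions on a set -/

/-- `IsSol2 Q y y' s`: on the set `s`, `y : ℝ → 𝕜` has derivative `y'` and `y'` has derivative
`Q t · y t` — a classical solution of `y'' = Q(t) y` on `s` together with its derivative
(Hartman, Ch. IV §1, the scalar second-order linear equation as a first-order system). [folklore] -/
structure IsSol2 (Q : ℝ → 𝕜) (y y' : ℝ → 𝕜) (s : Set ℝ) : Prop where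
  hasDerivAt : ∀ t ∈ s, HasDerivAt y (y' t) t
  hasDerivAt_deriv : ∀ t ∈ s, HasDerivAt y' (Q t * y t) t

namespace IsSol2

variable {Q : ℝ → 𝕜} {y y' z z' : ℝ → 𝕜} {s s' : Set ℝ}

/-- Restriction to a subset. [folklore] -/
theorem mono (h : IsSol2 Q y y' s) (hs : s' ⊆ s) : IsSol2 Q y y' s' :=
  ⟨fun t ht ↦ h.hasDerivAt t (hs ht), fun t ht ↦ h.hasDerivAt_deriv t (hs ht)⟩

/-- The zero solution. [folklore] -/
theorem zero : IsSol2 Q (fun _ ↦ (0 : 𝕜)) (fun _ ↦ 0) s :=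
  ⟨fun t _ ↦ hasDerivAt_const t 0, fun t _ ↦ by simpa using hasDerivAt_const t (0 : 𝕜)⟩

/-- Sums of solutions are solutions. [folklore] -/
theorem add (h₁ : IsSol2 Q y y' s) (h₂ : IsSol2 Q z z' s) :
    IsSol2 Q (fun t ↦ y t + z t) (fun t ↦ y' t + z' t) s :=
  ⟨fun t ht ↦ (h₁.hasDerivAt t ht).add (h₂.hasDerivAt t ht), fun t ht ↦
    ((h₁.hasDerivAt_deriv t ht).add (h₂.hasDerivAt_deriv t ht)).congr_deriv (by ring)⟩

/-- Scalar multiples of solutions are solutions. [folklore] -/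
theorem smul (h : IsSol2 Q y y' s) (c : 𝕜) :
    IsSol2 Q (fun t ↦ c * y t) (fun t ↦ c * y' t) s :=
  ⟨fun t ht ↦ (h.hasDerivAt t ht).const_mul c, fun t ht ↦
    ((h.hasDerivAt_deriv t ht).const_mul c).congr_deriv (by ring)⟩

/-- Negatives of solutions are solutions. [folklore] -/
theorem neg (h : IsSol2 Q y y' s) : IsSol2 Q (fun t ↦ -y t) (fun t ↦ -y' t) s :=
  ⟨fun t ht ↦ (h.hasDerivAt t ht).neg, fun t ht ↦
    ((h.hasDerivAt_deriv t ht).neg).congr_deriv (by ring)⟩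

/-- Differences of solutions are solutions. [folklore] -/
theorem sub (h₁ : IsSol2 Q y y' s) (h₂ : IsSol2 Q z z' s) :
    IsSol2 Q (fun t ↦ y t - z t) (fun t ↦ y' t - z' t) s := by
  simpa [sub_eq_add_neg] using h₁.add h₂.neg

/-- Linear combinations of two solutions are solutions. [folklore] -/
theorem combination (h₁ : IsSol2 Q y y' s) (h₂ : IsSol2 Q z z' s) (a b : 𝕜) :
    IsSol2 Q (fun t ↦ a * y t + b * z t) (fun t ↦ a * y' t + b * z' t) s :=
  (h₁.smul a).add (h₂.smul b)

/-- The solution and its derivative are continuous on `s`. [folklore] -/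
theorem continuousOn (h : IsSol2 Q y y' s) : ContinuousOn y s ∧ ContinuousOn y' s :=
  ⟨fun t ht ↦ (h.hasDerivAt t ht).continuousAt.continuousWithinAt,
    fun t ht ↦ (h.hasDerivAt_deriv t ht).continuousAt.continuousWithinAt⟩

/-- `deriv y = y'` on `s`. [folklore] -/
theorem deriv_eq (h : IsSol2 Q y y' s) {t : ℝ} (ht : t ∈ s) : deriv y t = y' t :=
  (h.hasDerivAt t ht).deriv

/-- The phrasing of `LinearSecondOrder.lean` (`p = 0`). [folklore] -/
theorem linForm (h : IsSol2 Q y y' s) :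
    ∀ t ∈ s, HasDerivAt y (y' t) t ∧ HasDerivAt y' ((0 : ℝ → 𝕜) t * y' t + Q t * y t) t :=
  fun t ht ↦ ⟨h.hasDerivAt t ht, by simpa using h.hasDerivAt_deriv t ht⟩

/-- Conversely, from the phrasing of `LinearSecondOrder.lean` with `p = 0`. [folklore] -/
theorem of_linForm
    (h : ∀ t ∈ s, HasDerivAt y (y' t) t ∧ HasDerivAt y' ((0 : ℝ → 𝕜) t * y' t + Q t * y t) t) :
    IsSol2 Q y y' s :=
  ⟨fun t ht ↦ (h t ht).1, fun t ht ↦ by simpa using (h t ht).2⟩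

/-- **Reflection `t ↦ −t`**: `y(−t)` solves the equation with coefficient `Q(−t)` on `−s`, with
derivative `−y'(−t)`. [folklore] -/
theorem comp_neg (h : IsSol2 Q y y' s) :
    IsSol2 (fun t ↦ Q (-t)) (fun t ↦ y (-t)) (fun t ↦ -y' (-t)) (-s) := by
  refine ⟨fun t ht ↦ ?_, fun t ht ↦ ?_⟩
  · have h1 := (h.hasDerivAt (-t) (by simpa using ht)).scomp t (hasDerivAt_neg t)
    exact h1.congr_deriv (by simp)
  · have h1 := ((h.hasDerivAt_deriv (-t) (by simpa using ht)).scomp t (hasDerivAt_neg t)).neg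
    exact h1.congr_deriv (by simp)

end IsSol2

/-! ## Existence and uniqueness on a half-line -/

/-- **Existence on `(r₀, ∞)` with prescribed data** (`Q` continuous there; the datum is
meaningful for `t₀ > r₀`). [cite: Hartman2002, Ch. IV Lemma 1.1] -/
theorem exists_isSol2_Ioi {Q : ℝ → 𝕜} {r₀ : ℝ} (hQ : ContinuousOn Q (Ioi r₀)) (t₀ : ℝ)
    (c₀ c₁ : 𝕜) : ∃ y y' : ℝ → 𝕜, IsSol2 Q y y' (Ioi r₀) ∧ y t₀ = c₀ ∧ y' t₀ = c₁ := by
  obtain ⟨u, u', h0, h1, h⟩ := exists_solution_Ioi (p := fun _ ↦ (0 : 𝕜)) continuousOn_const hQ t₀ c₀ c₁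
  exact ⟨u, u', IsSol2.of_linForm h, h0, h1⟩

namespace IsSol2

variable {Q : ℝ → 𝕜} {y y' z z' : ℝ → 𝕜} {r₀ : ℝ}

/-- **Uniqueness on `(r₀, ∞)`**: two solutions with the same data at some `t₀ > r₀` agree, together
with their derivatives. [cite: Hartman2002, Ch. IV Lemma 1.1] -/
theorem eqOn_Ioi (hQ : ContinuousOn Q (Ioi r₀)) (hy : IsSol2 Q y y' (Ioi r₀))
    (hz : IsSol2 Q z z' (Ioi r₀)) {t₀ : ℝ} (ht₀ : r₀ < t₀) (h0 : y t₀ = z t₀) (h1 : y' t₀ = z' t₀) :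
    EqOn y z (Ioi r₀) ∧ EqOn y' z' (Ioi r₀) := by
  suffices key : ∀ t ∈ Ioi r₀, y t = z t ∧ y' t = z' t from
    ⟨fun t ht ↦ (key t ht).1, fun t ht ↦ (key t ht).2⟩
  intro t ht
  set b : ℝ := max t t₀ + 1
  have hsub : Ioo r₀ b ⊆ Ioi r₀ := fun s hs ↦ hs.1
  have h := eqOn_of_solution_Ioo (p := fun _ ↦ (0 : 𝕜)) (a := r₀) (b := b) continuousOn_const
    (hQ.mono hsub) ⟨ht₀, by simp [b]; linarith [le_max_right t t₀]⟩
    (fun s hs ↦ hy.linForm s (hsub hs)) (fun s hs ↦ hz.linForm s (hsub hs)) h0 h1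
  have htb : t ∈ Ioo r₀ b := ⟨ht, by simp [b]; linarith [le_max_left t t₀]⟩
  exact ⟨h.1 htb, h.2 htb⟩

/-- A solution with vanishing data at some `t₀ > r₀` vanishes identically on `(r₀, ∞)`, together
with its derivative. [cite: Hartman2002, Ch. IV Cor. 1.1] -/
theorem eqOn_zero (hQ : ContinuousOn Q (Ioi r₀)) (hy : IsSol2 Q y y' (Ioi r₀)) {t₀ : ℝ}
    (ht₀ : r₀ < t₀) (h0 : y t₀ = 0) (h1 : y' t₀ = 0) :
    EqOn y 0 (Ioi r₀) ∧ EqOn y' 0 (Ioi r₀) :=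
  hy.eqOn_Ioi hQ IsSol2.zero ht₀ h0 h1

/-- Solutions of an equation with `C^∞` coefficient are `C^∞` on `(r₀, ∞)`.
[cite: Hartman2002, Ch. V Cor. 4.1] -/
theorem contDiffOn (hQ : ContDiffOn ℝ ∞ Q (Ioi r₀)) (hy : IsSol2 Q y y' (Ioi r₀)) :
    ContDiffOn ℝ ∞ y (Ioi r₀) ∧ ContDiffOn ℝ ∞ y' (Ioi r₀) :=
  contDiffOn_of_solution (p := fun _ ↦ (0 : 𝕜)) isOpen_Ioi contDiffOn_const hQ hy.linForm

end IsSol2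

/-! ## The Wronskian -/

/-- The Wronskian `W(y, z)(t) = y t · z' t − y' t · z t` of two pairs (function, derivative).
[cite: Hartman2002, Ch. IV §8 (8.4)] -/
def wronskian (y y' z z' : ℝ → 𝕜) (t : ℝ) : 𝕜 := y t * z' t - y' t * z t

/-- Antisymmetry of the Wronskian. [folklore] -/
theorem wronskian_swap (y y' z z' : ℝ → 𝕜) (t : ℝ) :
    wronskian z z' y y' t = -wronskian y y' z z' t := by
  unfold wronskian; ring

/-- `W(y, y) = 0`. [folklore] -/
theorem wronskian_self (y y' : ℝ → 𝕜) (t : ℝ) : wronskian y y' y y' t = 0 := by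
  simp [wronskian, mul_comm]

namespace IsSol2

variable {Q : ℝ → 𝕜} {y y' z z' w w' : ℝ → 𝕜} {s : Set ℝ} {r₀ : ℝ}

/-- Along two solutions of the same equation the Wronskian has derivative `0`
(`(y z' − y' z)' = y Q z − Q y z = 0`). [cite: Hartman2002, Ch. IV §8 (8.4)] -/
theorem hasDerivAt_wronskian (hy : IsSol2 Q y y' s) (hz : IsSol2 Q z z' s) {t : ℝ} (ht : t ∈ s) :
    HasDerivAt (wronskian y y' z z') 0 t := by
  have h := ((hy.hasDerivAt t ht).mul (hz.hasDerivAt_deriv t ht)).sub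
    ((hy.hasDerivAt_deriv t ht).mul (hz.hasDerivAt t ht))
  exact h.congr_deriv (by ring)

/-- **The Wronskian of two solutions is constant on `(r₀, ∞)`.** [cite: Hartman2002, Ch. IV §8 (8.4)] -/
theorem wronskian_eq (hy : IsSol2 Q y y' (Ioi r₀)) (hz : IsSol2 Q z z' (Ioi r₀)) {t₁ t₂ : ℝ}
    (h₁ : r₀ < t₁) (h₂ : r₀ < t₂) : wronskian y y' z z' t₁ = wronskian y y' z z' t₂ :=
  isOpen_Ioi.is_const_of_deriv_eq_zero isPreconnected_Ioi
    (fun _ ht ↦ (hy.hasDerivAt_wronskian hz ht).differentiableAt.differentiableWithinAt)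
    (fun _ ht ↦ (hy.hasDerivAt_wronskian hz ht).deriv) h₁ h₂

/-- **Basis representation.** If `y`, `z` solve the equation on `(r₀, ∞)` with Wronskian
`W(t₀) ≠ 0` at some `t₀ > r₀`, then every solution `w` is the combination
`w = a y + b z` with `a = W(w, z)(t₀)/W(t₀)`, `b = W(y, w)(t₀)/W(t₀)`, and likewise for the
derivatives (Cramer's rule for the data at `t₀`, then uniqueness).
[cite: Hartman2002, Ch. IV §8] -/
theorem eq_combination (hQ : ContinuousOn Q (Ioi r₀)) (hy : IsSol2 Q y y' (Ioi r₀))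
    (hz : IsSol2 Q z z' (Ioi r₀)) (hw : IsSol2 Q w w' (Ioi r₀)) {t₀ : ℝ} (ht₀ : r₀ < t₀)
    (hW : wronskian y y' z z' t₀ ≠ 0) :
    EqOn w (fun t ↦ wronskian w w' z z' t₀ / wronskian y y' z z' t₀ * y t +
        wronskian y y' w w' t₀ / wronskian y y' z z' t₀ * z t) (Ioi r₀) ∧
      EqOn w' (fun t ↦ wronskian w w' z z' t₀ / wronskian y y' z z' t₀ * y' t +
        wronskian y y' w w' t₀ / wronskian y y' z z' t₀ * z' t) (Ioi r₀) := by
  refine hw.eqOn_Ioi hQ (hy.combination hz _ _) ht₀ ?_ ?_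
  · field_simp
    unfold wronskian
    ring
  · field_simp
    unfold wronskian
    ring

/-- If the Wronskian of two solutions vanishes at `t₀ > r₀` and `y` has non-zero data there,
then `z` is a multiple of `y` on `(r₀, ∞)`. [cite: Hartman2002, Ch. IV §8] -/
theorem exists_eq_smul_of_wronskian_eq_zero (hQ : ContinuousOn Q (Ioi r₀))
    (hy : IsSol2 Q y y' (Ioi r₀)) (hz : IsSol2 Q z z' (Ioi r₀)) {t₀ : ℝ} (ht₀ : r₀ < t₀)
    (hW : wronskian y y' z z' t₀ = 0) (hne : y t₀ ≠ 0 ∨ y' t₀ ≠ 0) :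
    ∃ c : 𝕜, EqOn z (fun t ↦ c * y t) (Ioi r₀) ∧ EqOn z' (fun t ↦ c * y' t) (Ioi r₀) := by
  unfold wronskian at hW
  rcases hne with h | h
  · refine ⟨z t₀ / y t₀, hz.eqOn_Ioi hQ (hy.smul _) ht₀ ?_ ?_⟩
    · field_simp
    · field_simp
      linear_combination hW
  · refine ⟨z' t₀ / y' t₀, hz.eqOn_Ioi hQ (hy.smul _) ht₀ ?_ ?_⟩
    · field_simp
      linear_combination -hW
    · field_simp

end IsSol2

/-! ## The calculus of `‖y‖²` and `re (ȳ y')` -/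

/-- `d/dt ‖y t‖² = 2 re (conj (y t) · y' t)`. [folklore] -/
theorem hasDerivAt_normSq {y : ℝ → 𝕜} {d : 𝕜} {t : ℝ} (h : HasDerivAt y d t) :
    HasDerivAt (fun s ↦ ‖y s‖ ^ 2) (2 * RCLike.re (conj (y t) * d)) t := by
  have hre : HasDerivAt (fun s ↦ RCLike.re (y s)) (RCLike.re d) t := by
    have h1 := RCLike.reCLM.hasFDerivAt.comp_hasDerivAt t h
    simpa [Function.comp_def] using h1
  have him : HasDerivAt (fun s ↦ RCLike.im (y s)) (RCLike.im d) t := by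
    have h1 := RCLike.imCLM.hasFDerivAt.comp_hasDerivAt t h
    simpa [Function.comp_def] using h1
  have hfun : (fun s ↦ ‖y s‖ ^ 2) =
      fun s ↦ RCLike.re (y s) * RCLike.re (y s) + RCLike.im (y s) * RCLike.im (y s) := by
    funext s
    exact RCLike.norm_sq_eq_def
  rw [hfun]
  refine ((hre.mul hre).add (him.mul him)).congr_deriv ?_
  rw [RCLike.mul_re, RCLike.conj_re, RCLike.conj_im]
  ring

/-- `d/dt re (conj (y t) · y' t) = re (conj d · y' t) + re (conj (y t) · d')` when `y' = d`,
`(y')' = d'` at `t`. [folklore] -/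
theorem hasDerivAt_reInner {y y' : ℝ → 𝕜} {d d' : 𝕜} {t : ℝ} (h : HasDerivAt y d t)
    (h' : HasDerivAt y' d' t) :
    HasDerivAt (fun s ↦ RCLike.re (conj (y s) * y' s))
      (RCLike.re (conj d * y' t) + RCLike.re (conj (y t) * d')) t := by
  have hc : HasDerivAt (fun s ↦ conj (y s)) (conj d) t := by
    simpa only [starRingEnd_apply] using HasDerivAt.star h
  have hm := hc.mul h'
  have hre : HasDerivAt (fun s ↦ RCLike.re (conj (y s) * y' s))
      (RCLike.re (conj d * y' t + conj (y t) * d')) t := by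
    have h1 := RCLike.reCLM.hasFDerivAt.comp_hasDerivAt t hm
    simpa [Function.comp_def] using h1
  exact hre.congr_deriv (map_add _ _ _)

namespace IsSol2

variable {Q : ℝ → 𝕜} {y y' : ℝ → 𝕜} {s : Set ℝ}

/-- Along a solution, `d/dt ‖y‖² = 2 re (ȳ y')`. [folklore] -/
theorem hasDerivAt_normSq (hy : IsSol2 Q y y' s) {t : ℝ} (ht : t ∈ s) :
    HasDerivAt (fun s ↦ ‖y s‖ ^ 2) (2 * RCLike.re (conj (y t) * y' t)) t :=
  Literature.Analysis.ODE.hasDerivAt_normSq (hy.hasDerivAt t ht)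

/-- Along a solution, `d/dt re (ȳ y') = ‖y'‖² + re Q · ‖y‖²`. [folklore] -/
theorem hasDerivAt_reInner (hy : IsSol2 Q y y' s) {t : ℝ} (ht : t ∈ s) :
    HasDerivAt (fun s ↦ RCLike.re (conj (y s) * y' s))
      (‖y' t‖ ^ 2 + RCLike.re (Q t) * ‖y t‖ ^ 2) t := by
  have h := Literature.Analysis.ODE.hasDerivAt_reInner (hy.hasDerivAt t ht) (hy.hasDerivAt_deriv t ht)
  refine h.congr_deriv ?_
  have h1 : RCLike.re (conj (y' t) * y' t) = ‖y' t‖ ^ 2 := by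
    rw [RCLike.conj_mul, ← RCLike.ofReal_pow, RCLike.ofReal_re]
  have h2 : RCLike.re (conj (y t) * (Q t * y t)) = RCLike.re (Q t) * ‖y t‖ ^ 2 := by
    rw [show conj (y t) * (Q t * y t) = Q t * (conj (y t) * y t) by ring, RCLike.conj_mul,
      ← RCLike.ofReal_pow, RCLike.re_mul_ofReal]
  rw [h1, h2]

end IsSol2

/-! ## Continuous dependence on the coefficient (Grönwall) -/

/-- The phase field `(y₁, y₂) ↦ (y₂, Q t · y₁)` of `y'' = Q y` on `𝕜 × 𝕜`. [folklore] -/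
def sol2Field (Q : ℝ → 𝕜) (t : ℝ) (v : 𝕜 × 𝕜) : 𝕜 × 𝕜 := (v.2, Q t * v.1)

/-- `sol2Field Q t` is Lipschitz with constant `max 1 ‖Q t‖`. [folklore] -/
theorem lipschitzWith_sol2Field (Q : ℝ → 𝕜) (t : ℝ) :
    LipschitzWith ⟨max 1 ‖Q t‖, le_max_of_le_left zero_le_one⟩ (sol2Field Q t) := by
  refine LipschitzWith.of_dist_le_mul fun v w ↦ ?_
  simp only [sol2Field, dist_eq_norm, Prod.norm_def, Prod.fst_sub, Prod.snd_sub, ← mul_sub, norm_mul]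
  change max ‖v.2 - w.2‖ (‖Q t‖ * ‖v.1 - w.1‖) ≤ max 1 ‖Q t‖ * max ‖v.1 - w.1‖ ‖v.2 - w.2‖
  refine max_le ?_ ?_
  · calc ‖v.2 - w.2‖ ≤ 1 * max ‖v.1 - w.1‖ ‖v.2 - w.2‖ := by rw [one_mul]; exact le_max_right _ _
      _ ≤ max 1 ‖Q t‖ * max ‖v.1 - w.1‖ ‖v.2 - w.2‖ := by gcongr; exact le_max_left _ _
  · gcongr
    · exact le_max_right _ _
    · exact le_max_left _ _

namespace IsSol2

variable {Q₁ Q₂ : ℝ → 𝕜} {y y' z z' : ℝ → 𝕜} {s : Set ℝ}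

/-- The phase curve of a solution is an integral curve of `sol2Field`. [folklore] -/
theorem hasDerivAt_phase (hy : IsSol2 Q₁ y y' s) {t : ℝ} (ht : t ∈ s) :
    HasDerivAt (fun τ ↦ (y τ, y' τ)) (sol2Field Q₁ t (y t, y' t)) t :=
  (hy.hasDerivAt t ht).prodMk (hy.hasDerivAt_deriv t ht)

/-- **Continuous dependence, forward in time.** For solutions `y` of `y'' = Q₁ y` and `z` of
`z'' = Q₂ z` on a set containing `[t₀, b]`, with `‖Q₁‖ ≤ K` (`K ≥ 1`), `‖Q₁ − Q₂‖ ≤ η` and `‖z‖ ≤ P`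
on `[t₀, b]`: `dist (y t, y' t) (z t, z' t) ≤ gronwallBound δ K (η P) (t − t₀)` on `[t₀, b]`, `δ` the
distance of the data at `t₀`. [cite: Hartman2002, Ch. V Thm. 2.1] -/
theorem dist_le_right (hy : IsSol2 Q₁ y y' s) (hz : IsSol2 Q₂ z z' s) {t₀ b K η P : ℝ}
    (hsub : Icc t₀ b ⊆ s) (hK : ∀ t ∈ Icc t₀ b, ‖Q₁ t‖ ≤ K) (hK1 : 1 ≤ K)
    (hη : ∀ t ∈ Icc t₀ b, ‖Q₁ t - Q₂ t‖ ≤ η) (hP : ∀ t ∈ Icc t₀ b, ‖z t‖ ≤ P) (hη0 : 0 ≤ η) :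
    ∀ t ∈ Icc t₀ b, dist (y t, y' t) (z t, z' t) ≤
      gronwallBound (dist (y t₀, y' t₀) (z t₀, z' t₀)) K (η * P) (t - t₀) := by
  intro t ht
  lift K to ℝ≥0 using zero_le_one.trans hK1 with K' hK'
  have key := dist_le_of_approx_trajectories_ODE_of_mem
    (v := sol2Field Q₁) (s := fun _ ↦ univ) (K := K')
    (f := fun τ ↦ (y τ, y' τ)) (g := fun τ ↦ (z τ, z' τ))
    (f' := fun τ ↦ sol2Field Q₁ τ (y τ, y' τ))
    (g' := fun τ ↦ sol2Field Q₂ τ (z τ, z' τ))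
    (a := t₀) (b := b) (εf := 0) (εg := η * P) (δ := dist (y t₀, y' t₀) (z t₀, z' t₀))
    (fun τ hτ ↦ ((lipschitzWith_sol2Field Q₁ τ).weaken (by
        change max 1 ‖Q₁ τ‖ ≤ (K' : ℝ)
        exact max_le hK1 (hK τ (Ico_subset_Icc_self hτ)))).lipschitzOnWith)
    (fun τ hτ ↦ (hy.hasDerivAt_phase (hsub hτ)).continuousAt.continuousWithinAt)
    (fun τ hτ ↦ (hy.hasDerivAt_phase (hsub (Ico_subset_Icc_self hτ))).hasDerivWithinAt)
    (fun τ _ ↦ by simp)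
    (fun τ _ ↦ mem_univ _)
    (fun τ hτ ↦ (hz.hasDerivAt_phase (hsub hτ)).continuousAt.continuousWithinAt)
    (fun τ hτ ↦ (hz.hasDerivAt_phase (hsub (Ico_subset_Icc_self hτ))).hasDerivWithinAt)
    (fun τ hτ ↦ by
      have h1 : dist (sol2Field Q₂ τ (z τ, z' τ)) (sol2Field Q₁ τ (z τ, z' τ)) =
          ‖Q₁ τ - Q₂ τ‖ * ‖z τ‖ := by
        change dist (z' τ, Q₂ τ * z τ) (z' τ, Q₁ τ * z τ) = _
        rw [Prod.dist_eq, dist_self, dist_eq_norm, ← sub_mul, norm_mul, norm_sub_rev,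
          max_eq_right (by positivity)]
      rw [h1]
      exact mul_le_mul (hη τ (Ico_subset_Icc_self hτ)) (hP τ (Ico_subset_Icc_self hτ))
        (norm_nonneg _) hη0)
    (fun τ _ ↦ mem_univ _)
    le_rfl t ht
  rwa [zero_add] at key

/-- **Continuous dependence, backward in time**: the estimate of `dist_le_right` on `[a, t₀]`
with `t₀ − t` in place of `t − t₀` (reflection `t ↦ −t`). [cite: Hartman2002, Ch. V Thm. 2.1] -/
theorem dist_le_left (hy : IsSol2 Q₁ y y' s) (hz : IsSol2 Q₂ z z' s) {a t₀ K η P : ℝ}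
    (hsub : Icc a t₀ ⊆ s) (hK : ∀ t ∈ Icc a t₀, ‖Q₁ t‖ ≤ K) (hK1 : 1 ≤ K)
    (hη : ∀ t ∈ Icc a t₀, ‖Q₁ t - Q₂ t‖ ≤ η) (hP : ∀ t ∈ Icc a t₀, ‖z t‖ ≤ P) (hη0 : 0 ≤ η) :
    ∀ t ∈ Icc a t₀, dist (y t, y' t) (z t, z' t) ≤
      gronwallBound (dist (y t₀, y' t₀) (z t₀, z' t₀)) K (η * P) (t₀ - t) := by
  intro t ht
  have hsub' : Icc (-t₀) (-a) ⊆ -s := fun τ hτ ↦ by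
    have : -τ ∈ Icc a t₀ := ⟨by linarith [hτ.2], by linarith [hτ.1]⟩
    simpa using hsub this
  have h := dist_le_right hy.comp_neg hz.comp_neg (t₀ := -t₀) (b := -a) (K := K) (η := η)
    (P := P) hsub' (fun τ hτ ↦ hK (-τ) ⟨by linarith [hτ.2], by linarith [hτ.1]⟩) hK1
    (fun τ hτ ↦ hη (-τ) ⟨by linarith [hτ.2], by linarith [hτ.1]⟩)
    (fun τ hτ ↦ hP (-τ) ⟨by linarith [hτ.2], by linarith [hτ.1]⟩) hη0 (-t)
    ⟨by linarith [ht.2], by linarith [ht.1]⟩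
  simp only [neg_neg] at h
  have hd : ∀ (p q p' q' : 𝕜), dist (p, -q) (p', -q') = dist (p, q) (p', q') := fun p q p' q' ↦ by
    rw [Prod.dist_eq, Prod.dist_eq, dist_neg_neg]
  rw [hd, hd] at h
  convert h using 2
  ring

/-- `gronwallBound δ K ε x ≤ (δ + ε x) e^{K x}` for `K ≥ 1`, `ε ≥ 0`. [folklore] -/
theorem gronwallBound_le {δ K ε x : ℝ} (hK : 1 ≤ K) (hε : 0 ≤ ε) :
    gronwallBound δ K ε x ≤ (δ + ε * x) * Real.exp (K * x) := by
  have hK0 : K ≠ 0 := by positivity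
  have hKpos : 0 < K := by positivity
  rw [gronwallBound_of_K_ne_0 hK0, add_mul]
  -- `(e^{Kx} − 1)/K ≤ x e^{Kx}`
  have h1 : Real.exp (K * x) - 1 ≤ K * x * Real.exp (K * x) := by
    have := Real.add_one_le_exp (-(K * x))
    have hpos := Real.exp_pos (K * x)
    have hprod : Real.exp (-(K * x)) * Real.exp (K * x) = 1 := by
      rw [← Real.exp_add]; simp
    nlinarith
  have h2 : ε / K * (Real.exp (K * x) - 1) ≤ ε * x * Real.exp (K * x) := by
    calc ε / K * (Real.exp (K * x) - 1) ≤ ε / K * (K * x * Real.exp (K * x)) := by gcongr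
      _ = ε * x * Real.exp (K * x) := by field_simp
  linarith

/-- **Continuous dependence on a compact interval `[a, b] ∋ t₀`** (both directions):
`dist (y t, y' t) (z t, z' t) ≤ (δ + η P (b − a)) e^{K (b − a)}` on `[a, b]`, where `δ` is the
distance of the data at `t₀`, `‖Q₁‖ ≤ K` (`K ≥ 1`), `‖Q₁ − Q₂‖ ≤ η`, `‖z‖ ≤ P` on `[a, b]`.
[cite: Hartman2002, Ch. V Thm. 2.1] -/
theorem dist_le (hy : IsSol2 Q₁ y y' s) (hz : IsSol2 Q₂ z z' s) {a b t₀ K η P : ℝ}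
    (hsub : Icc a b ⊆ s) (ht₀ : t₀ ∈ Icc a b) (hK : ∀ t ∈ Icc a b, ‖Q₁ t‖ ≤ K) (hK1 : 1 ≤ K)
    (hη : ∀ t ∈ Icc a b, ‖Q₁ t - Q₂ t‖ ≤ η) (hP : ∀ t ∈ Icc a b, ‖z t‖ ≤ P) (hη0 : 0 ≤ η)
    (hP0 : 0 ≤ P) :
    ∀ t ∈ Icc a b, dist (y t, y' t) (z t, z' t) ≤
      (dist (y t₀, y' t₀) (z t₀, z' t₀) + η * P * (b - a)) * Real.exp (K * (b - a)) := by
  intro t ht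
  have hεx : 0 ≤ η * P := by positivity
  have hba : 0 ≤ b - a := by linarith [ht₀.1, ht₀.2]
  have h0 : 0 ≤ dist (y t₀, y' t₀) (z t₀, z' t₀) + η * P * (b - a) :=
    add_nonneg dist_nonneg (mul_nonneg hεx hba)
  rcases le_total t₀ t with h | h
  · have hs : Icc t₀ b ⊆ Icc a b := Icc_subset_Icc_left ht₀.1
    have h1 := hy.dist_le_right hz (hs.trans hsub) (fun τ hτ ↦ hK τ (hs hτ)) hK1
      (fun τ hτ ↦ hη τ (hs hτ)) (fun τ hτ ↦ hP τ (hs hτ)) hη0 t ⟨h, ht.2⟩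
    refine h1.trans ((gronwallBound_le hK1 hεx).trans ?_)
    have hx : t - t₀ ≤ b - a := by linarith [ht.2, ht₀.1]
    gcongr
  · have hs : Icc a t₀ ⊆ Icc a b := Icc_subset_Icc_right ht₀.2
    have h1 := hy.dist_le_left hz (hs.trans hsub) (fun τ hτ ↦ hK τ (hs hτ)) hK1
      (fun τ hτ ↦ hη τ (hs hτ)) (fun τ hτ ↦ hP τ (hs hτ)) hη0 t ⟨ht.1, h⟩
    refine h1.trans ((gronwallBound_le hK1 hεx).trans ?_)
    have hx : t₀ - t ≤ b - a := by linarith [ht.1, ht₀.2]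
    gcongr

end IsSol2

end Literature.Analysis.ODE
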